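import Summits.SmoothPoincare4.SmoothPoincare4.Theorems.HeegaardHandlebodyCongruenceClosed.Negative.GenusThreeAutomorphisms

/-!
# `HeegaardHandlebodyCongruenceClosed` — negative-side support (3/5): non-gate certificates; no level suffices

The certificate engine (`commute_of_kills`, `not_inGate_zero_of_cert`: a hom `S₃ → Q` killing the
generators of `N₁` and of `ρN₂` with two non-commuting values proves `ρ ∉ (A∩B)·C`, because
`S₃/(N₁ ⊔ N₂) ≅ ℤ` is abelian), the certified facts `ρ₀ ∉ P`, `ρ₁ ∉ P`, the mod-2 homology level
`M₂` (characteristic, finite index) with `ρ₁ ≡ id (mod M₂)`, and the refuted strengthenings of the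
crux: its conclusion is not universal; ONE level never suffices — not even `M₂`, and in fact (uniform
form, dihedral certificates `S₃ → D_{2d+1}` along the powers of `θ`) NO level at all: for every
characteristic finite-index `M` some `θ^{2d} ≡ id (mod M)` lies outside the gate, i.e. the gate has
empty interior in the congruence topology. [folklore]
-/

namespace Summit.SmoothPoincare4.SmoothPoincare4.Theorems.HeegaardHandlebodyCongruenceClosed.Negative

open Literature.Topology.FourManifolds Subgroup

section GenusThree

open SurfaceGroup
open Summit.SmoothPoincare4.SmoothPoincare4.Theorems.ShadowApproximation.Negative
  (surfaceRelator_three of_eq_a of_eq_b rel_three lift_surfaceRelator_three liftHom liftHom_of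
    liftHom_a liftHom_b)

/-! ### Non-gate certificates at genus 3

If `ρ = x ∘ c` with `x ∈ Stab N₀ ∩ Stab N₁`, `c ∈ Stab N₂`, then `x` carries the pair `(N₁, N₂)`
onto `(N₁, ρN₂)`, so `S₃ ⧸ (N₁ ⊔ ρN₂) ≅ S₃ ⧸ (N₁ ⊔ N₂) = ⟨b₂⟩ ≅ ℤ` is **abelian**. A hom `f` to any
group killing `N₁` and `ρ N₂` with two non-commuting values therefore certifies `ρ ∉ (A∩B)·C`. -/

/-- at genus 3, a hom killing `a₀, b₀, a₁, b₁, a₂` (i.e. `N₁ ⊔ N₂`) has abelian image [folklore] -/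
theorem commute_of_kills {Q : Type*} [Group Q] (φ : SurfaceGroup 3 →* Q)
    (h1 : φ (a 0) = 1) (h2 : φ (b 0) = 1) (h3 : φ (a 1) = 1) (h4 : φ (b 1) = 1) (h5 : φ (a 2) = 1)
    (s t : SurfaceGroup 3) : φ s * φ t = φ t * φ s := by
  let ε : SurfaceGroup 3 →* Multiplicative ℤ :=
    SurfaceGroup.toCommGroup (fun p => if p = ((2 : Fin 3), true) then Multiplicative.ofAdd 1 else 1)
  have hφ : φ = (zpowersHom Q (φ (b 2))).comp ε := by
    apply PresentedGroup.ext
    rintro ⟨i, _ | _⟩ <;> fin_cases i <;>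
      simp [ε, of_eq_a, of_eq_b, h1, h2, h3, h4, h5]
  rw [hφ]
  simp only [MonoidHom.comp_apply, zpowersHom_apply]
  exact zpow_mul_comm _ _ _

/-- helper lemma `a_mem_s4Kernels_one` (see the module docstring). [folklore] -/
theorem a_mem_s4Kernels_one : (a 0 : SurfaceGroup 3) ∈ s4Kernels 1 :=
  subset_normalClosure (by simp)
/-- helper lemma `b_mem_s4Kernels_one` (see the module docstring). [folklore] -/
theorem b_mem_s4Kernels_one : (b 1 : SurfaceGroup 3) ∈ s4Kernels 1 :=
  subset_normalClosure (by simp)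
/-- helper lemma `a_two_mem_s4Kernels_one` (see the module docstring). [folklore] -/
theorem a_two_mem_s4Kernels_one : (a 2 : SurfaceGroup 3) ∈ s4Kernels 1 :=
  subset_normalClosure (by simp)
/-- helper lemma `b_mem_s4Kernels_two` (see the module docstring). [folklore] -/
theorem b_mem_s4Kernels_two : (b 0 : SurfaceGroup 3) ∈ s4Kernels 2 :=
  subset_normalClosure (by simp)
/-- helper lemma `a_mem_s4Kernels_two` (see the module docstring). [folklore] -/
theorem a_mem_s4Kernels_two : (a 1 : SurfaceGroup 3) ∈ s4Kernels 2 :=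
  subset_normalClosure (by simp)
/-- helper lemma `a_two_mem_s4Kernels_two` (see the module docstring). [folklore] -/
theorem a_two_mem_s4Kernels_two : (a 2 : SurfaceGroup 3) ∈ s4Kernels 2 :=
  subset_normalClosure (by simp)

/-- **Non-gate certificate (genus 3).** A hom `f : S₃ → Q` killing the generators `a₀, b₁, a₂` of
`N₁` and the generators `ρ b₀, ρ a₁, ρ a₂` of `ρ N₂`, with two non-commuting values, shows
`ρ ∉ (Stab N₀ ∩ Stab N₁)·Stab N₂`. [folklore] -/
theorem not_inGate_zero_of_cert {Q : Type*} [Group Q] (ρ : SurfaceGroup 3 ≃* SurfaceGroup 3)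
    (f : SurfaceGroup 3 →* Q) (hf0 : f (a 0) = 1) (hf1 : f (b 1) = 1) (hf2 : f (a 2) = 1)
    (hρ0 : f (ρ (b 0)) = 1) (hρ1 : f (ρ (a 1)) = 1) (hρ2 : f (ρ (a 2)) = 1)
    (s t : SurfaceGroup 3) (hne : f s * f t ≠ f t * f s) : ρ ∉ gate 0 := by
  intro h
  obtain ⟨x, -, h1, h2⟩ := (inGate_iff 0 ρ).1 h
  change (s4Kernels 1).map x.toMonoidHom = s4Kernels 1 at h1
  change (s4Kernels 2).map x.toMonoidHom = (s4Kernels 2).map ρ.toMonoidHom at h2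
  have k1 : s4Kernels 1 ≤ f.ker := by
    refine normalClosure_le_normal ?_
    rintro _ (rfl | rfl | rfl) <;> simpa
  have k2 : (s4Kernels 2).map ρ.toMonoidHom ≤ f.ker := by
    rw [show s4Kernels 2 = normalClosure {b 0, a 1, a 2} from rfl, map_normalClosure _ _ ρ.surjective]
    refine normalClosure_le_normal ?_
    rintro _ ⟨_, (rfl | rfl | rfl), rfl⟩ <;> simpa
  have viaN1 : ∀ g ∈ s4Kernels 1, f (x g) = 1 := fun g hg =>
    k1 (h1.le (mem_map_of_mem x.toMonoidHom hg))
  have viaN2 : ∀ g ∈ s4Kernels 2, f (x g) = 1 := fun g hg =>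
    k2 (h2.le (mem_map_of_mem x.toMonoidHom hg))
  have comm := commute_of_kills (f.comp x.toMonoidHom)
    (viaN1 _ a_mem_s4Kernels_one) (viaN2 _ b_mem_s4Kernels_two) (viaN2 _ a_mem_s4Kernels_two)
    (viaN1 _ b_mem_s4Kernels_one) (viaN1 _ a_two_mem_s4Kernels_one) (x.symm s) (x.symm t)
  exact hne (by simpa using comm)

/-! ### The certificates for `ρ₀` and `ρ₁` (values in the symmetric group `Perm (Fin 3)`) -/

/-- generator images: `b₀ ↦ (0 1 2)`, `b₂ ↦ (0 1)`, all others `↦ 1` [folklore] -/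
def cert0Fun (p : surfaceGen 3) : Equiv.Perm (Fin 3) :=
  if p = (0, true) then finRotate 3 else if p = (2, true) then Equiv.swap 0 1 else 1

/-- generator images: `a₁ ↦ (0 1 2)`, `b₂ ↦ (0 1)`, all others `↦ 1` [folklore] -/
def cert1Fun (p : surfaceGen 3) : Equiv.Perm (Fin 3) :=
  if p = (1, false) then finRotate 3 else if p = (2, true) then Equiv.swap 0 1 else 1

/-- helper lemma `cert0Fun_rel` (see the module docstring). [folklore] -/
theorem cert0Fun_rel : FreeGroup.lift cert0Fun (surfaceRelator 3) = 1 := by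
  rw [lift_surfaceRelator_three]; simp [cert0Fun]

/-- helper lemma `cert1Fun_rel` (see the module docstring). [folklore] -/
theorem cert1Fun_rel : FreeGroup.lift cert1Fun (surfaceRelator 3) = 1 := by
  rw [lift_surfaceRelator_three]; simp [cert1Fun]

/-- certificate hom for `ρ₀` [folklore] -/
def cert0 : SurfaceGroup 3 →* Equiv.Perm (Fin 3) := liftHom cert0Fun cert0Fun_rel
/-- certificate hom for `ρ₁` [folklore] -/
def cert1 : SurfaceGroup 3 →* Equiv.Perm (Fin 3) := liftHom cert1Fun cert1Fun_rel

/-- **`ρ₀ ∉ (A∩B)·C`.** (`S₃ ⧸ (N₁ ⊔ ρ₀N₂) = F⟨b₀, b₂⟩` is free of rank 2, not `ℤ`.) [folklore] -/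
theorem not_inGate_rho0 : rho0 ∉ gate 0 := by
  refine not_inGate_zero_of_cert rho0 cert0 ?_ ?_ ?_ ?_ ?_ ?_ (b 0) (b 2) ?_
  iterate 6 simp [cert0, cert0Fun]
  simp only [cert0, liftHom_b]
  decide

/-- **`ρ₁ ∉ (A∩B)·C`.** (`S₃ ⧸ (N₁ ⊔ ρ₁N₂) = ⟨a₁, b₂ ∣ a₁³⟩ ≅ ℤ/3 ∗ ℤ`, the group of
`L(3,1) # S¹×S²`: changing the gluing of the standard genus-3 splitting of `S¹×S²` by `T_c^{2}`,
`c` the `(1,1)`-curve on an `S³`-summand torus, produces a lens-space summand.) [folklore] -/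
theorem not_inGate_rho1 : rho1 ∉ gate 0 := by
  refine not_inGate_zero_of_cert rho1 cert1 ?_ ?_ ?_ ?_ ?_ ?_ (a 1) (b 2) ?_
  · simp [cert1, cert1Fun]
  · simp [cert1, cert1Fun]
  · simp [cert1, cert1Fun]
  · simp [cert1, cert1Fun]
  · simp only [rho1_a1, map_mul, cert1, liftHom_a, liftHom_b]
    decide
  · simp [cert1, cert1Fun]
  · simp only [cert1, liftHom_a, liftHom_b]
    decide

/-! ### The level-2 congruence subgroup `M₂ = ker (S₃ → H₁(S₃; 𝔽₂))` -/

/-- homs to `𝔽₂` from generator values [folklore] -/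
def homZ2 (v : surfaceGen 3 → Multiplicative (ZMod 2)) : SurfaceGroup 3 →* Multiplicative (ZMod 2) :=
  SurfaceGroup.toCommGroup v

/-- `M₂ = [S₃,S₃]·S₃² = ⋂ ker (S₃ → 𝔽₂)`, the mod-2 homology kernel. [folklore] -/
def M2 : Subgroup (SurfaceGroup 3) := ⨅ v, (homZ2 v).ker

/-- helper lemma `mem_M2` (see the module docstring). [folklore] -/
theorem mem_M2 {s : SurfaceGroup 3} : s ∈ M2 ↔ ∀ v, homZ2 v s = 1 := by
  simp [M2, Subgroup.mem_iInf, MonoidHom.mem_ker]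

/-- instance `M2_finiteIndex` (see the module docstring). [folklore] -/
instance M2_finiteIndex : M2.FiniteIndex := Subgroup.finiteIndex_iInf fun _ => inferInstance

/-- every hom to `𝔽₂` is a `homZ2` [folklore] -/
theorem eq_homZ2 (f : SurfaceGroup 3 →* Multiplicative (ZMod 2)) :
    f = homZ2 (fun p => f (PresentedGroup.of p)) :=
  PresentedGroup.ext fun p => by simp [homZ2]

/-- helper lemma `M2_characteristic` (see the module docstring). [folklore] -/
theorem M2_characteristic : M2.Characteristic := by
  refine Subgroup.characteristic_iff_le_comap.2 fun φ s hs => ?_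
  rw [Subgroup.mem_comap, mem_M2]
  intro v
  have := (mem_M2.1 hs) (fun p => homZ2 v (φ (PresentedGroup.of p)))
  rw [← MonoidHom.comp_apply, eq_homZ2 ((homZ2 v).comp φ.toMonoidHom)]
  simpa using this

/-- `ρ₁ ≡ id (mod M₂)`: the square of a Dehn twist acts trivially on mod-2 homology. [folklore] -/
theorem rho1_congr_M2 (s : SurfaceGroup 3) : rho1 s * s⁻¹ ∈ M2 := by
  rw [mem_M2]
  intro v
  suffices h : (homZ2 v).comp rho1.toMonoidHom = homZ2 v by
    have := DFunLike.congr_fun h s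
    simp only [MonoidHom.comp_apply, MulEquiv.coe_toMonoidHom] at this
    rw [map_mul, map_inv, this, mul_inv_cancel]
  have sq1 : ∀ p q : Multiplicative (ZMod 2), p * q * p * q * p = p := by decide
  have sq2 : ∀ p q : Multiplicative (ZMod 2), p⁻¹ * q⁻¹ * p⁻¹ = q := by decide
  apply PresentedGroup.ext
  rintro ⟨i, _ | _⟩ <;> fin_cases i <;> simp [homZ2, of_eq_a, of_eq_b, sq1, sq2]

/-- hence `ρ₁ ∈ (A∩B)·C·K_{M₂}` with `x = c = 1` [folklore] -/
theorem inGateMod_rho1_M2 : rho1 ∈ gateMod 0 M2 :=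
  ⟨MulEquiv.refl _, MulEquiv.refl _, by simp, by simp, by simp,
    fun s => by simpa using rho1_congr_M2 s⟩

/-! ### Refuted natural strengthenings of the crux (I): the conclusion alone; one level -/

/-- STRENGTHENING 1 REFUTED (drop the hypothesis): NOT every automorphism is a product `x ∘ c` —
`ρ₀ ∉ (A∩B)·C` at genus 3 (`m = 0`). [folklore] -/
theorem heegaardHandlebodyCongruenceClosed_conclusion_not_universal :
    ¬ ∀ (m : ℕ) (ρ : S m ≃* S m), ρ ∈ gate m := fun h => not_inGate_rho0 (h 0 rho0)

/-- STRENGTHENING 2 REFUTED (one level instead of all): congruence to a gate element modulo ONE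
characteristic finite-index subgroup does not force gate membership — contentfully, at the mod-2
homology level `M₂` with the squared Dehn twist `ρ₁ = T_c²`. Any proof of the crux must use the
intersection over infinitely many levels. [folklore] -/
theorem heegaardHandlebodyCongruenceClosed_false_with_one_level :
    ¬ ∀ (m : ℕ) (ρ : S m ≃* S m) (M : Subgroup (S m)), M.Characteristic → M.FiniteIndex →
        ρ ∈ gateMod m M → ρ ∈ gate m := fun h =>
  not_inGate_rho1 (h 0 rho1 M2 M2_characteristic M2_finiteIndex inGateMod_rho1_M2)

/-- STRENGTHENING 3 REFUTED (pointwise form of 2): `ρ ≡ id (mod M₂)` does not imply `ρ ∈ (A∩B)·C`.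
[folklore] -/
theorem heegaardHandlebodyCongruenceClosed_false_with_level_two :
    ¬ ∀ ρ : SurfaceGroup 3 ≃* SurfaceGroup 3, (∀ s, ρ s * s⁻¹ ∈ M2) → ρ ∈ gate 0 := fun h =>
  not_inGate_rho1 (h rho1 rho1_congr_M2)

/-! ### No level suffices at all: the gate has empty interior in the congruence topology (genus 3)

For EVERY characteristic finite-index `M ≤ S₃` there is an automorphism `≡ id (mod M)` outside the gate:
a power `θ^{2d}` of the `(1,1)`-twist of handle 1, `d` the order of the permutation induced by `θ` on
the finite group `S₃/M`. The certificate is uniform: `S₃ → D_{2d+1}` (dihedral), `a₁ ↦ r 1`,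
`b₂ ↦ sr 0`; indeed `S₃/(N₁ ⊔ θ^{k}N₂) = ⟨a₁, b₂ ∣ a₁^{k+1}⟩ ≅ ℤ/(k+1) ∗ ℤ` (lens-space summand
`L(k+1,1)`). -/

/-- `θ` as an element of the group `MulAut S₃` (to take powers). [folklore] -/
def thetaAut : MulAut (SurfaceGroup 3) := theta

/-- helper lemma `thetaAut_apply` (see the module docstring). [folklore] -/
@[simp] theorem thetaAut_apply (s : SurfaceGroup 3) : thetaAut s = theta s := rfl

/-- helper lemma `thetaAut_pow_a0` (see the module docstring). [folklore] -/
theorem thetaAut_pow_a0 (k : ℕ) : (thetaAut ^ k) (a 0) = a 0 := by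
  induction k with
  | zero => simp
  | succ k ih => rw [pow_succ, MulAut.mul_apply, thetaAut_apply, theta_a0, ih]

/-- helper lemma `thetaAut_pow_b0` (see the module docstring). [folklore] -/
theorem thetaAut_pow_b0 (k : ℕ) : (thetaAut ^ k) (b 0) = b 0 := by
  induction k with
  | zero => simp
  | succ k ih => rw [pow_succ, MulAut.mul_apply, thetaAut_apply, theta_b0, ih]

/-- helper lemma `thetaAut_pow_a2` (see the module docstring). [folklore] -/
theorem thetaAut_pow_a2 (k : ℕ) : (thetaAut ^ k) (a 2) = a 2 := by
  induction k with
  | zero => simp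
  | succ k ih => rw [pow_succ, MulAut.mul_apply, thetaAut_apply, theta_a2, ih]

/-- helper lemma `thetaAut_pow_b2` (see the module docstring). [folklore] -/
theorem thetaAut_pow_b2 (k : ℕ) : (thetaAut ^ k) (b 2) = b 2 := by
  induction k with
  | zero => simp
  | succ k ih => rw [pow_succ, MulAut.mul_apply, thetaAut_apply, theta_b2, ih]

/-- generator images of the dihedral certificate: `a₁ ↦ r 1`, `b₂ ↦ sr 0`, all others `↦ 1` [folklore] -/
def certDFun (n : ℕ) (p : surfaceGen 3) : DihedralGroup n :=
  if p = (1, false) then DihedralGroup.r 1 else if p = (2, true) then DihedralGroup.sr 0 else 1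

/-- helper lemma `certDFun_rel` (see the module docstring). [folklore] -/
theorem certDFun_rel (n : ℕ) : FreeGroup.lift (certDFun n) (surfaceRelator 3) = 1 := by
  rw [lift_surfaceRelator_three]; simp [certDFun]

/-- the dihedral certificate hom `S₃ → D_n` [folklore] -/
def certD (n : ℕ) : SurfaceGroup 3 →* DihedralGroup n := liftHom (certDFun n) (certDFun_rel n)

/-- helper lemma `certD_a0` (see the module docstring). [folklore] -/
@[simp] theorem certD_a0 (n : ℕ) : certD n (a 0) = 1 := by simp [certD, certDFun]
/-- helper lemma `certD_b0` (see the module docstring). [folklore] -/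
@[simp] theorem certD_b0 (n : ℕ) : certD n (b 0) = 1 := by simp [certD, certDFun]
/-- helper lemma `certD_a1` (see the module docstring). [folklore] -/
@[simp] theorem certD_a1 (n : ℕ) : certD n (a 1) = DihedralGroup.r 1 := by simp [certD, certDFun]
/-- helper lemma `certD_b1` (see the module docstring). [folklore] -/
@[simp] theorem certD_b1 (n : ℕ) : certD n (b 1) = 1 := by simp [certD, certDFun]
/-- helper lemma `certD_a2` (see the module docstring). [folklore] -/
@[simp] theorem certD_a2 (n : ℕ) : certD n (a 2) = 1 := by simp [certD, certDFun]
/-- helper lemma `certD_b2` (see the module docstring). [folklore] -/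
@[simp] theorem certD_b2 (n : ℕ) : certD n (b 2) = DihedralGroup.sr 0 := by simp [certD, certDFun]

/-- the dihedral certificate along the orbit of `(a₁, b₁)` under powers of `θ`:
`θ^k(a₁) ↦ r (k+1)`, `θ^k(b₁) ↦ r (-k)` (all in the rotation subgroup). [folklore] -/
theorem certD_thetaAut_pow (n k : ℕ) :
    certD n ((thetaAut ^ k) (a 1)) = DihedralGroup.r ((k : ZMod n) + 1) ∧
      certD n ((thetaAut ^ k) (b 1)) = DihedralGroup.r (-(k : ZMod n)) := by
  induction k with
  | zero => simp
  | succ k ih =>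
    obtain ⟨iha, ihb⟩ := ih
    refine ⟨?_, ?_⟩
    · rw [pow_succ, MulAut.mul_apply, thetaAut_apply, theta_a1]
      simp only [map_mul, iha, ihb, DihedralGroup.r_mul_r]
      congr 1
      push_cast
      ring
    · rw [pow_succ, MulAut.mul_apply, thetaAut_apply, theta_b1]
      simp only [map_inv, iha, DihedralGroup.inv_r]
      congr 1
      push_cast
      ring

/-- **No single level suffices, uniformly: the gate has empty interior in the congruence topology.**
For every characteristic finite-index `M ≤ S₃` there is `ρ ≡ id (mod M)` (pointwise) with
`ρ ∉ (A∩B)·C`, namely `ρ = θ^{2d}` with `d` the order of `θ` acting on `S₃/M`. [folklore] -/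
theorem exists_congr_not_inGate (M : Subgroup (SurfaceGroup 3)) (hM : M.Characteristic)
    (hfi : M.FiniteIndex) :
    ∃ ρ : SurfaceGroup 3 ≃* SurfaceGroup 3, (∀ s, ρ s * s⁻¹ ∈ M) ∧ ρ ∉ gate 0 := by
  haveI := hM
  haveI := hfi
  have hmap : M.map (theta : SurfaceGroup 3 →* SurfaceGroup 3) = M :=
    Subgroup.characteristic_iff_map_eq.1 hM theta
  let σ : SurfaceGroup 3 ⧸ M ≃* SurfaceGroup 3 ⧸ M := QuotientGroup.congr M M theta hmap
  let τ : Equiv.Perm (SurfaceGroup 3 ⧸ M) := σ.toEquiv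
  have hτ : ∀ (k : ℕ) (s : SurfaceGroup 3),
      (τ ^ k) (QuotientGroup.mk s) = QuotientGroup.mk ((thetaAut ^ k) s) := by
    intro k
    induction k with
    | zero => intro s; simp
    | succ k ih =>
      intro s
      rw [pow_succ', Equiv.Perm.mul_apply, ih, pow_succ', MulAut.mul_apply]
      rfl
  set d := orderOf τ with hd
  have hdpos : 0 < d := (isOfFinOrder_of_finite τ).orderOf_pos
  have hτd : τ ^ d = 1 := pow_orderOf_eq_one τ
  refine ⟨thetaAut ^ (2 * d), fun s => ?_, ?_⟩
  · have h1 : (τ ^ (2 * d)) (QuotientGroup.mk s) = QuotientGroup.mk s := by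
      rw [mul_comm, pow_mul, hτd, one_pow, Equiv.Perm.one_apply]
    rw [hτ] at h1
    rw [← div_eq_mul_inv, ← QuotientGroup.eq_iff_div_mem]
    exact h1
  · haveI : Fact (2 < 2 * d + 1) := ⟨by omega⟩
    refine not_inGate_zero_of_cert (thetaAut ^ (2 * d)) (certD (2 * d + 1)) (certD_a0 _) (certD_b1 _)
      (certD_a2 _) ?_ ?_ ?_ (a 1) (b 2) ?_
    · rw [thetaAut_pow_b0, certD_b0]
    · rw [(certD_thetaAut_pow (2 * d + 1) (2 * d)).1, ← DihedralGroup.r_zero]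
      congr 1
      have h := ZMod.natCast_self (2 * d + 1)
      push_cast at h ⊢
      linear_combination h
    · rw [thetaAut_pow_a2, certD_a2]
    · rw [certD_a1, certD_b2, DihedralGroup.r_mul_sr, DihedralGroup.sr_mul_r, zero_sub, zero_add, ne_eq,
        DihedralGroup.sr.injEq]
      exact ZMod.neg_one_ne_one

/-- STRENGTHENING 2′ REFUTED (uniform form of 2): there is NO level `M` at which congruence to a gate
element forces gate membership — the gate has empty interior in the congruence topology of `Aut S₃`.
[folklore] -/
theorem heegaardHandlebodyCongruenceClosed_false_with_any_one_level :
    ¬ ∃ M : Subgroup (SurfaceGroup 3), M.Characteristic ∧ M.FiniteIndex ∧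
        ∀ ρ : SurfaceGroup 3 ≃* SurfaceGroup 3, ρ ∈ gateMod 0 M → ρ ∈ gate 0 := by
  rintro ⟨M, hM, hfi, h⟩
  obtain ⟨ρ, hρ, hnot⟩ := exists_congr_not_inGate M hM hfi
  exact hnot (h ρ ⟨MulEquiv.refl _, MulEquiv.refl _, by simp, by simp, by simp,
    fun s => by simpa using hρ s⟩)

end GenusThree

end Summit.SmoothPoincare4.SmoothPoincare4.Theorems.HeegaardHandlebodyCongruenceClosed.Negative
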